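import Mathlib.Analysis.SpecialFunctions.Pow.Real
import Literature.Computability.Cryptography.FGComplexity
import Literature.Computability.Cryptography.FGProblemZoo
import Literature.Computability.FineGrained.FineGrainedWave0
import Literature.Computability.FineGrained.Conjectures
import Literature.Computability.FineGrained.SatAlgorithms
import HarnessLib
import HarnessLib.Audit

-- provenance: harness21/H21/H21/Statements/FineGrained/SETHHardness.lean @ 2388ea9 (interim HEAD d8f2665); M5 mechanical rewrite
/-!
# Fine-grained complexity: SETH-, ETH- and NSETH-based hardness (family `fine-grained`)

Statement file for the conditional lower bounds of fine-grained complexity, over the word RAM /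
`FGProblem` layer of `Literature.Prelude.CryptoQuantFine.FGComplexity`, the problem zoo
`Literature.Prelude.CryptoQuantFine.FGProblemZoo`, Wave0's `SETH`/`ETH`
(`Literature.Statements.FineGrained.Wave0`), `OVConjectureDet` of
`Literature.Statements.FineGrained.Conjectures` and `NSETH` of
`Literature.Statements.FineGrained.SatAlgorithms`.

Contents:

* `KSATInRAMTime`, `SETHWordRAM`: the word-RAM form of SETH (the form used in the fine-grained
  literature, VVW ICM 2018, §3, Hypothesis 1) — an OPEN CONJECTURE, registered here as a
  hypothesis (`[status: open]`), never to be discharged — and its relation to Wave0's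
  Turing-machine `SETH` (`seth_of_sethWordRAM`);
* **fine-grained.S09** SETH ⇒ OV conjecture, and `k`-OV needs `n^{k-o(1)}`
  (R. Williams, *A new algorithm for optimal 2-constraint satisfaction and its implications*,
  TCS 348 (2005), Thm. 5.1/§5; Pătraşcu–Williams, SODA 2010 for `k`-OV);
* **fine-grained.S14** SETH ⇒ no `O(n^{2-ε})` edit distance (Backurs–Indyk, STOC 2015, Thm. 1);
* **fine-grained.S15** SETH ⇒ no `O(n^{2-ε})` LCS / DTW / discrete Fréchet
  (Abboud–Backurs–Vassilevska Williams, FOCS 2015, Thm. 1; Bringmann–Künnemann, FOCS 2015,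
  Thm. 1.2; Bringmann, FOCS 2014, Thm. 1.1);
* **fine-grained.S16** SETH ⇒ no `(3/2-δ)`-approximate diameter in `O(m^{2-ε})` on sparse graphs
  (Roditty–Vassilevska Williams, STOC 2013, Thm. 1.3);
* **fine-grained.S18** `k`-Dominating Set in `O(n^{k-ε})` ⇒ ¬ SETH (Pătraşcu–Williams, SODA 2010,
  Thm. 1.2);
* **fine-grained.S23** ETH ⇒ `k`-Clique has no `f(k) n^{o(k)}` algorithm (Chen–Huang–Kanj–Xia,
  JCSS 72 (2006), Thms. 5.3/5.5);
* **fine-grained.S20** NSETH ⇒ no deterministic fine-grained reduction from SAT to 3SUM / APSP at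
  the conjectured exponents (Carmosino–Gao–Impagliazzo–Mihajlin–Paturi–Schneider, ITCS 2016).

## Mathlib

Mathlib has none of these problems or hypotheses (searched `SETH`, `OrthogonalVectors`,
`editDist`, `levenshtein`, `Frechet` (only the analytic Fréchet derivative), `DominatingSet`,
`FineGrained`: no relevant hits; Mathlib's only machine models are `Turing.TM0/TM1/TM2`). Used
from Mathlib: `Real.rpow`, `Nat.floor` (`⌊·⌋₊`), `Filter.Tendsto`, `Filter.atTop`, `nhds`.

## Design choices

* **Machine models (review item; OUTLINE D1).** Wave0's `SETH` is a statement about multi-stack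
  Turing machines (`KSATInExpTime k δ` = some `Turing.FinTM2` decides `k`-SAT in
  `2^{δ n} · poly(L)`), whereas all lower bounds below are word-RAM lower bounds
  (`FGProblem.InTimeO`). The printed theorems (Williams 2005, Backurs–Indyk, ABVW, BK, Bringmann,
  Roditty–VW, Pătraşcu–Williams) take SETH *and* the lower bound in the RAM model: an
  `n^{2-ε}` word-RAM algorithm for OV yields a `2^{(1-ε/2)n}` *word-RAM* `k`-SAT algorithm; since
  a time-`T` word RAM is only known to be simulated by a multitape/multistack TM with polynomial
  (≈ `T²`) overhead, this refutes RAM-SETH but is not known to refute TM-SETH. Conversely a RAM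
  with `Θ(n)`-bit words simulates a `FinTM2` step by step with constant overhead, so
  RAM-SETH ⇒ TM-SETH (`seth_of_sethWordRAM`). We therefore define the word-RAM hypothesis
  `SETHWordRAM` (via `KSATInRAMTime`) and use it as the hypothesis of S09/S14/S15/S16 and as the
  (negated) conclusion of S18: these are then exactly the printed theorems. The word size of a
  `KSATInRAMTime` run on a formula with `n` variables is `k' * (n + width)`, i.e. `Θ(n)` bits
  (not the `Θ(log L)` bits of `FGProblem.InTimeInst`): exponential-time SAT algorithms
  (split-and-list, the OV reduction, the `k`-Dominating-Set reduction) address `2^{Θ(n)}` memory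
  cells, which `Θ(log L)`-bit words cannot do; `+ width` guarantees the input is stored exactly.
  ETH (S23) is model-robust (`2^{o(n)}` survives polynomial overhead) and NSETH (S20) is a
  guess-and-verify TM notion that can check a guessed RAM trace in `Õ(T)` time, so Wave0's `ETH`
  and `SatAlgorithms.NSETH` are used there unchanged.
* **Retired: `ovConjectureDet_of_seth` (TM hypothesis; deleted 2026-08-14, verdict
  `misstated`).** The outline's literal signature `SETH → OVConjectureDet` (Wave0's multi-stack
  Turing-machine `SETH` as hypothesis, the word-RAM lower bound `OVConjectureDet` as conclusion;
  the model-independence reading of SETH of OUTLINE D1) was vendored here as a named fact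
  `[claim: …, status: under-review]` until its prove seat concluded, and this clean-up re-verified
  against the sources, that it is *not* the theorem in print. The sources work in ONE machine
  model, the word RAM with `O(log n)`-bit words — VVW IPEC 2015, §2: "Since we are focusing on
  exact running times, we need to fix the model of computation. Here we assume that we are working
  with a Word RAM model with `O(log n)` bit words", with SETH = Conj. 3, OVC = Conj. 4 and
  "`k`-SAT `≤_{2ⁿ,n²}` OV" = §4, Thm. 7 (LIPIcs numbering); likewise VVW ICM 2018, §2–3 and
  Williams, TCS 348 (2005), §5.1 — and by the previous bullet carrying the split-and-list `k`-SAT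
  algorithm from the word RAM over to multi-stack Turing machines at SETH granularity needs a
  subpolynomial-overhead simulation of RAMs by Turing machines, which is not known (Cook–Reckhow,
  JCSS 7 (1973), §2: polynomial overhead). The distinction is made explicitly in print by
  Gajulapalli–Golovnev–King–Saraogi, *Online Orthogonal Vectors Revisited* (SODA 2026,
  arXiv:2605.04798), §2.1, footnote: "a `2^{n/2}` RAM algorithm for SAT would not necessarily
  imply a Turing machine solving SAT in fewer than `2ⁿ` steps. Therefore, such an algorithm would
  refute SETH stated for RAM algorithms but not the Turing machines version of SETH." The
  CORRECTED statement — hypothesis and conclusion in the one model of the sources — is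
  `ovConjectureDet_of_sethWordRAM` below (unchanged; it was already the faithful form). The
  cross-model implication survives only as an explicit proposition in
  `Literature.Computability.FineGrained.OVFromSETH` (`ovConjectureDet_of_seth_of_bridge`: it is
  exactly the printed theorem plus the open bridge `SETH → SETHWordRAM`;
  `ovConjectureDet_of_seth_iff`: it says that a truly subquadratic word-RAM OV algorithm refutes
  *Turing-machine* SETH). `Literature.Computability.FineGrained.Sweep1.ethr2_lower_bound_of_seth`,
  whose interim proof went through the retired fact and whose docstring still names it, inherits
  the same cross-model gap. No statement in this file uses the TM-model `SETH` as a hypothesis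
  for a RAM lower bound.
* All target statements are theorems in print, hence `theorem … := by sorry`; hypotheses
  `SETHWordRAM`, `SETH`, `ETH`, `NSETH` are `def … : Prop`s and are *assumed*, never asserted.
* Lower bounds "no `O(n^{c-ε})` algorithm for any `ε > 0`" are `∀ ε > 0, ¬ P.InTimeO (n ^ (c-ε))`
  with real exponents (`Real.rpow`), deterministic word RAM (`FGProblem.InTimeO`), exactly as in
  `Conjectures.lean`. SETH is a hypothesis about deterministic algorithms, so it yields
  deterministic lower bounds (the randomised versions would need randomised SETH).
* `k`-OV (S09): the regime `d = c log n` is the accepted `kOVWithDim k c` (same rounding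
  convention as `OVWithDim`); the conclusion `∃ c, 1 ≤ c ∧ …` mirrors `OVConjectureDet`
  (`c = 0` is the documented junk regime of `kOVWithDim`).
* DTW (S15): the zoo's `DTW c` has entries in `[-n^c, n^c]`; the SETH lower bound of
  Abboud–Backurs–Vassilevska Williams / Bringmann–Künnemann already holds for one-dimensional
  curves over a constant-size set of values, so it is stated for every `c ≥ 1` (for `c ≥ 1` and
  `n` large the range `[-n, n]` contains any fixed finite value set; instances of bounded size are
  finitely many and absorbed in the `O(·)`). `c = 0` (values in `{-1, 0, 1}`) is not claimed.
* Diameter (S16): `DiameterGapApprox α` (size measure `m` = number of edges, connected sparse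
  graphs) with `α = 3/2 - δ`, `δ : ℚ`, `0 < δ < 1/2` (so `1 < α`; Roditty–VW state it for every
  `δ > 0`, and for `δ ≥ 1/2` the claim only gets weaker but leaves the approximation regime).
* `k`-Clique (S23): "`f(k) · n^{o(k)}` time" is rendered with the per-instance bound
  `FGProblem.InTimeInst`: there are `f : ℕ → ℕ` and an exponent function `g : ℕ → ℝ` with
  `g k / k → 0` such that every instance `I` (clique size `I.k`, `I.n` vertices) is solved within
  `f I.k * (⌊I.n ^ g I.k⌋₊ + 1)` steps (Chen–Huang–Kanj–Xia, JCSS 2006, Thm. 5.5, "`f(k) m^{o(k)}`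
  for any function `f`"; no computability of `f` is required in the non-uniform-in-`k` form).
  The additive `+ 1` is the implicit `O(·)` and avoids the size-`0` vacuity (`(0:ℝ) ^ g k = 0`
  steps would refute every program on the empty graph); it only weakens the requirement on the
  `∃`-witness, so the negated statement is still the theorem in print.
* NSETH non-reducibility (S20; OUTLINE R8): the inventory text reads "no deterministic
  fine-grained reduction from SAT to 3SUM / APSP *at the conjectured exponents*", i.e. from
  `(CNF-SAT, 2ⁿ)` to `(3SUM, n²)` and to `(APSP, n³)`; CGIMPS prove sharper thresholds
  (`(3SUM, n^{3/2+γ})`, APSP at its nondeterministic exponent) which are not pinned by the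
  inventory and are *not* asserted. **Source problem.** The bare carrier `CNFSAT` admits
  unboundedly many (repeated) clauses on `n` variables, so `FGReducible CNFSAT …` is vacuously
  false (`FGProblemZoo` module docstring); the statements are made about `CNFSATWithSize c`
  (`numClauses + size ≤ (n+1)ᶜ`) with `2 ≤ c`, budget `n ↦ 2 ^ n`. For `2 ≤ c` and `n` large,
  `CNFSATWithSize c` contains every sparsified `k`-CNF (IPZ sparsification: `≤ f(k, δ) · n`
  clauses), so a deterministic fine-grained reduction from `(CNFSATWithSize c, 2ⁿ)` to
  `(3SUM, n²)` combined with the co-nondeterministic 3SUM algorithm would refute NSETH — the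
  statement is genuinely the CGIMPS consequence. `c = 1` is *not* claimed.
-/

namespace Literature.Computability.FineGrained

open Filter Topology Cryptography Cryptography.WordRAM

/-! ### Word-RAM SETH -/

/-- `KSATInRAMTime k δ`: `k`-SAT (the accepted `kSATProblem k`: width `≤ k`, no repeated clause,
size `n = numVars`) is solvable on the deterministic word RAM in time `O(2^{δ n})`, i.e. some
deterministic oracle-free program, run with word size `k' * (n + width φ)` (`Θ(n)`-bit words, so
that `2^{Θ(n)}` memory cells are addressable and the input is stored exactly), outputs an accepted
answer on every instance `φ` within `⌊C · 2^{δ n} + C⌋₊` steps. The `poly(L)` factor of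
Impagliazzo–Paturi's `2^{δ n} poly(L)` is dropped: `L = n^{O(k)}` for `kSATProblem k`, and SETH
quantifies over all savings `ε`, so it is immaterial for `SETHWordRAM`. (Impagliazzo–Paturi,
JCSS 62 (2001), §1; VVW ICM 2018, §2–3.)
[cite: ImpagliazzoPaturiJCSS2001, §1] [cite: VassilevskaWilliamsICM2018, §2–3] -/
def KSATInRAMTime (k : ℕ) (δ : ℝ) : Prop :=
  ∃ (M : Program) (k' : ℕ) (C : ℝ), M.IsDeterministic ∧ M.IsOracleFree ∧
    ∀ φ : (kSATProblem k).Inst, ∃ out ∈ (kSATProblem k).Good φ,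
      OutputsWithin M (k' * ((kSATProblem k).size φ + (kSATProblem k).width φ)) noOracle
        zeroCoins ((kSATProblem k).encode φ) out
        ⌊C * (2 : ℝ) ^ (δ * ((kSATProblem k).size φ : ℝ)) + C⌋₊

/-- OPEN CONJECTURE — **Word-RAM SETH**, the Strong Exponential Time Hypothesis in the machine
model of fine-grained complexity. POSED (not proved) by Impagliazzo–Paturi and named by
Calabro–Impagliazzo–Paturi, IWPEC 2009, §1 (p. 3 of the authors' version): "[IP01] proposed the
open question whether `s_∞ = 1`, which we will call the Strongly Exponential-Time Hypothesis
(SETH). The best known upper bounds for `s_k` are all of the form `1 - 1/O(k)`, which makes the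
conjecture SETH plausible"; restated as a conjecture in the word-RAM model by VVW IPEC 2015, §2,
Conj. 3 and VVW ICM 2018, §3, Hypothesis 1. [status: open] — a registered open statement, used
only as a hypothesis `(h : SETHWordRAM)`; there is deliberately no `SETHWordRAM_holds` (a proof
would in particular separate P from NP), and the name is kept (rather than `…Conjecture`) because
`SETHHardnessProofs`, `CliqueETH` and `OVFromSETH` use it.

Statement: for every `ε > 0` there is `k ≥ 3` such that `k`-SAT on `n` variables has no
deterministic word-RAM algorithm running in time `O(2^{(1-ε) n})` (`KSATInRAMTime`). This is the
*deterministic* form (VVW ICM 2018, §3, Hypothesis 1: "no `O(2^{(1-ε)n})` time algorithm";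
Gajulapalli–Golovnev–King–Saraogi, *Online Orthogonal Vectors Revisited*, SODA 2026,
arXiv:2605.04798, Def. 2.4: "no deterministic algorithm solves `k`-SAT on formulas with `n`
variables in time `2^{(1-ε)n}`"); CIP 2009 define `s_k` over randomized algorithms and IPEC 2015,
Conj. 3 says "in expectation" — *stronger* hypotheses, each implying this one. The side condition
`3 ≤ k` is immaterial (`sethWordRAM_iff` in `SETHHardnessProofs.lean`). Compare Wave0's
Turing-machine `SETH`; see the module docstring ("Machine models"): `SETHWordRAM → SETH` is
`seth_of_sethWordRAM`, the converse is not known.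
[cite: CalabroImpagliazzoPaturiIWPEC2009, §1 (where SETH is posed)]
[cite: VassilevskaWilliamsICM2018, §3 Hypothesis 1] -/
@[conjecture] def SETHWordRAM : Prop :=
  ∀ ε : ℝ, 0 < ε → ∃ k : ℕ, 3 ≤ k ∧ ¬ KSATInRAMTime k (1 - ε)

/-- Monotonicity of `KSATInRAMTime` in the exponent. [folklore] -/
theorem KSATInRAMTime.mono {k : ℕ} {δ δ' : ℝ} (h : KSATInRAMTime k δ) (hδ : δ ≤ δ') :
    KSATInRAMTime k δ' := by
  obtain ⟨M, k', C, hdet, hof, hM⟩ := h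
  refine ⟨M, k', max C 0, hdet, hof, fun φ => ?_⟩
  obtain ⟨out, hout, hrun⟩ := hM φ
  refine ⟨out, hout, hrun.mono (Nat.floor_le_floor ?_)⟩
  have h0 : (0 : ℝ) ≤ max C 0 := le_max_right _ _
  have h1 : (0 : ℝ) ≤ (2 : ℝ) ^ (δ * ((kSATProblem k).size φ : ℝ)) := by positivity
  have h2 : (2 : ℝ) ^ (δ * ((kSATProblem k).size φ : ℝ)) ≤
      (2 : ℝ) ^ (δ' * ((kSATProblem k).size φ : ℝ)) :=
    Real.rpow_le_rpow_of_exponent_le (by norm_num)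
      (mul_le_mul_of_nonneg_right hδ (Nat.cast_nonneg _))
  calc C * (2 : ℝ) ^ (δ * ((kSATProblem k).size φ : ℝ)) + C
      ≤ max C 0 * (2 : ℝ) ^ (δ * ((kSATProblem k).size φ : ℝ)) + max C 0 :=
        add_le_add (mul_le_mul_of_nonneg_right (le_max_left _ _) h1) (le_max_left _ _)
    _ ≤ max C 0 * (2 : ℝ) ^ (δ' * ((kSATProblem k).size φ : ℝ)) + max C 0 := by
        gcongr

/-- A multi-stack Turing machine (`Turing.FinTM2`) deciding `k`-SAT in time `2^{δ n} poly(L)` is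
simulated step by step, with constant overhead, by a word RAM with `Θ(n)`-bit words (each stack
is a memory segment plus a height pointer `≤ 2^{δ n} poly(L) < 2^{Θ(n)}`); the `poly(L) = n^{O(k)}`
factor is absorbed by any increase of the exponent. Folklore (Cook–Reckhow, JCSS 7 (1973), §2;
VVW ICM 2018, §2). [cite: VassilevskaWilliamsICM2018, §2] -/
def kSATInRAMTime_of_kSATInExpTime : Prop :=
  ∀ {k : ℕ} {δ δ' : ℝ} (h : KSATInExpTime k δ) (hδ : δ < δ'),
    KSATInRAMTime k δ'

/-- Word-RAM SETH implies Wave0's Turing-machine SETH (a fast TM algorithm is a fast RAM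
algorithm). The converse is not known: simulating a time-`T` word RAM on a multitape Turing
machine costs polynomial (≈ `T²`), not quasi-linear, overhead. (Folklore; VVW ICM 2018, §2.)
[cite: VassilevskaWilliamsICM2018, §2] -/
def seth_of_sethWordRAM : Prop :=
  ∀ (h : SETHWordRAM),
    SETH

/- interim proof relied on results that are now named facts (D-0014); demoted to a fact by the M5 import, proof preserved:
:= by
  intro ε hε
  obtain ⟨k, hk, hnot⟩ := h (ε / 2) (half_pos hε)
  exact ⟨k, hk, fun hTM => hnot (kSATInRAMTime_of_kSATInExpTime hTM (by linarith))⟩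
-/

/-! ### fine-grained.S09: SETH ⇒ OV -/

/-- **fine-grained.S09** (R. Williams, TCS 348 (2005), Thm. 5.1 and its corollary; VVW ICM 2018,
§3, Thm. 3.1.) Word-RAM SETH implies the (deterministic) OV conjecture: for every `ε > 0` there is
`c ≥ 1` such that OV on `n` vectors of dimension `d = c ⌊log₂ n⌋` (`OVWithDim c`) has no
deterministic `O(n^{2-ε})`-time word-RAM algorithm. (If for some `ε > 0` and every `c ≥ 1` it had
one, CNF-SAT on `n` variables and `cn` clauses would be solvable in `2^{(1-ε/2) n} poly` time for
every `c`, refuting SETH via sparsification.) Hypothesis and conclusion live in the one machine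
model of the sources (word RAM; VVW IPEC 2015, §2, §4 Thm. 7); this is the faithful statement of
S09 and the CORRECTED form of the retired cross-model fact `ovConjectureDet_of_seth`
(`SETH → OVConjectureDet` with Wave0's Turing-machine `SETH`; deleted 2026-08-14 as misstated, see
the module docstring, "Retired", and `OVFromSETH.ovConjectureDet_of_seth_of_bridge`). Decomposed
and assembled (from two word-RAM named facts) in `OVFromSETH.ovConjectureDet_of_sethWordRAM_of`.
[cite: WilliamsTCS2005, Thm. 5.1] [cite: VassilevskaWilliamsICM2018, §3 Thm. 3.1] -/
def ovConjectureDet_of_sethWordRAM : Prop :=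
  ∀ (h : SETHWordRAM),
    OVConjectureDet

/-- **fine-grained.S09** (R. Williams, TCS 348 (2005), §5; Pătraşcu–Williams, SODA 2010, §1;
VVW ICM 2018, §3: "`k`-OV requires `n^{k-o(1)}` time under SETH".) Assuming word-RAM SETH, for
every `k ≥ 2` and `ε > 0` there is a constant `c ≥ 1` such that `k`-OV on `n` vectors per list
in dimension `d = c ⌊log₂ n⌋` (`kOVWithDim k c`) has no deterministic `O(n^{k-ε})`-time
algorithm (same shape as `OVConjectureDet`).
[cite: WilliamsTCS2005, §5] [cite: PatrascuWilliams2010, §1] -/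
def not_kOVWithDim_inTimeO_of_sethWordRAM : Prop :=
  ∀ (h : SETHWordRAM) (k : ℕ) (hk : 2 ≤ k) (ε : ℝ) (hε : 0 < ε),
    ∃ c : ℕ, 1 ≤ c ∧ ¬ (kOVWithDim k c).InTimeO fun n => (n : ℝ) ^ ((k : ℝ) - ε)

/-! ### fine-grained.S14: edit distance -/

/-- **fine-grained.S14** (Backurs–Indyk, *Edit distance cannot be computed in strongly
subquadratic time (unless SETH is false)*, STOC 2015, Thm. 1; binary alphabet by
Bringmann–Künnemann, FOCS 2015.) Assuming word-RAM SETH, for every `ε > 0` the edit distance of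
two binary strings of total length `n` cannot be computed in `O(n^{2-ε})` time.
[cite: BackursIndykSTOC2015, Thm. 1] [cite: BringmannKunnemannFOCS2015, Thm. 1.2] -/
def not_editDistance_inTimeO_of_sethWordRAM : Prop :=
  ∀ (h : SETHWordRAM) (ε : ℝ) (hε : 0 < ε),
    ¬ EditDistance.InTimeO fun n => (n : ℝ) ^ (2 - ε)

/-! ### fine-grained.S15: LCS, DTW, discrete Fréchet -/

/-- **fine-grained.S15** (Abboud–Backurs–Vassilevska Williams, *Tight hardness results for LCS
and other sequence similarity measures*, FOCS 2015, Thm. 1; binary alphabet: Bringmann–Künnemann,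
FOCS 2015, Thm. 1.2.) Assuming word-RAM SETH, for every `ε > 0` the longest common subsequence
of two binary strings of total length `n` cannot be computed in `O(n^{2-ε})` time.
[cite: AbboudBackursVassilevskaWilliamsFOCS2015, Thm. 1] [cite: BringmannKunnemannFOCS2015, Thm. 1.2] -/
def not_lcs_inTimeO_of_sethWordRAM : Prop :=
  ∀ (h : SETHWordRAM) (ε : ℝ) (hε : 0 < ε),
    ¬ LCS.InTimeO fun n => (n : ℝ) ^ (2 - ε)

/-- **fine-grained.S15** (Abboud–Backurs–Vassilevska Williams, FOCS 2015, Thm. 1;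
Bringmann–Künnemann, *Quadratic conditional lower bounds for string problems and dynamic time
warping*, FOCS 2015, Thm. 1.2.) Assuming word-RAM SETH, for every `c ≥ 1` and `ε > 0`, dynamic
time warping of two one-dimensional integer sequences of total length `n` with entries in
`[-n^c, n^c]` cannot be computed in `O(n^{2-ε})` time. (The sources prove it already for a
constant-size value set; see the module docstring for the choice `1 ≤ c`.)
[cite: AbboudBackursVassilevskaWilliamsFOCS2015, Thm. 1] [cite: BringmannKunnemannFOCS2015, Thm. 1.2] -/
def not_dtw_inTimeO_of_sethWordRAM : Prop :=
  ∀ (h : SETHWordRAM) (c : ℕ) (hc : 1 ≤ c) (ε : ℝ) (hε : 0 < ε),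
    ¬ (DTW c).InTimeO fun n => (n : ℝ) ^ (2 - ε)

/-- **fine-grained.S15** (K. Bringmann, *Why walking the dog takes time: Fréchet distance has no
strongly subquadratic algorithms unless SETH fails*, FOCS 2014, Thm. 1.1, discrete case.)
Assuming word-RAM SETH, for every `ε > 0` the decision version of the discrete Fréchet distance
of two planar integer point sequences of total length `n` ("is `d_dF(P, Q) ≤ √τ²`?") has no
`O(n^{2-ε})`-time algorithm. [cite: BringmannFOCS2014, Thm. 1.1 (discrete case)] -/
def not_discreteFrechetDecision_inTimeO_of_sethWordRAM : Prop :=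
  ∀ (h : SETHWordRAM) (ε : ℝ) (hε : 0 < ε),
    ¬ DiscreteFrechetDecision.InTimeO fun n => (n : ℝ) ^ (2 - ε)

/-! ### fine-grained.S16: approximate diameter of sparse graphs -/

/-- **fine-grained.S16** (Roditty–Vassilevska Williams, *Fast approximation algorithms for the
diameter and radius of sparse graphs*, STOC 2013, Thm. 1.3.) Assuming word-RAM SETH, for all
`ε > 0` and `0 < δ < 1/2` there is no `O(m^{2-ε})`-time algorithm that `(3/2 - δ)`-approximates
the diameter of connected undirected unweighted graphs with `m` edges, i.e. outputs `D` with
`diam / (3/2 - δ) ≤ D ≤ diam` (`DiameterGapApprox (3/2 - δ)`, size measure `m`).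
[cite: RodittyVassilevskaWilliamsSTOC2013, Thm. 1.3] -/
def not_diameterGapApprox_inTimeO_of_sethWordRAM : Prop :=
  ∀ (h : SETHWordRAM) (ε : ℝ) (hε : 0 < ε) (δ : ℚ) (hδ : 0 < δ) (hδ' : δ < 1 / 2),
    ¬ (DiameterGapApprox (3 / 2 - δ)).InTimeO fun m => (m : ℝ) ^ (2 - ε)

/-! ### fine-grained.S18: `k`-Dominating Set -/

/-- **fine-grained.S18** (Pătraşcu–Williams, *On the possibility of faster SAT algorithms*,
SODA 2010, Thm. 1.2.) If for some `k ≥ 3` and `ε > 0` the `k`-Dominating Set problem on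
`n`-vertex graphs is solvable in `O(n^{k-ε})` time on the word RAM, then CNF-SAT on `n` variables
and `m` clauses is solvable in `2^{(1-ε') n} poly(m)` time on the word RAM for some `ε' > 0`, so
word-RAM SETH fails. [cite: PatrascuWilliams2010, Thm. 1.2] -/
def not_sethWordRAM_of_kDominatingSet_inTimeO : Prop :=
  ∀ (h : ∃ k : ℕ, 3 ≤ k ∧ ∃ ε : ℝ, 0 < ε ∧ (kDominatingSet k).InTimeO fun n => (n : ℝ) ^ ((k : ℝ) - ε)),
    ¬ SETHWordRAM

/-! ### fine-grained.S23: `k`-Clique under ETH -/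

/-- **fine-grained.S23** (Chen–Huang–Kanj–Xia, *Strong computational lower bounds via
parameterized complexity*, JCSS 72 (2006), Thm. 5.5 (`k`-Clique is `W_l[1]`-hard, hence has no
`f(k) m^{o(k)}` algorithm unless SNP ⊆ SUBEXP, i.e. unless ETH fails by IPZ sparsification; the
generic statement is Thm. 5.3, the bounded-parameter form Thm. 5.7); cf. Chen et al.,
Inf. Comput. 201 (2005).)
Assuming ETH, `k`-Clique on `n`-vertex graphs has no `f(k) · n^{o(k)}`-time algorithm: there are
no `f : ℕ → ℕ` and exponent function `g` with `g(k)/k → 0` such that a single word-RAM program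
decides every instance `I` (clique size `I.k`, `I.n` vertices) within
`f(I.k) · (⌊I.n ^ g(I.k)⌋ + 1)` steps (the `+ 1` is the implicit `O(·)`; without it the bound
would be `0` steps on the empty graph, see the module docstring). ETH is robust under polynomial
overhead, so Wave0's Turing-machine `ETH` is the printed hypothesis here.
[cite: ChenHuangKanjXiaJCSS2006, Thm. 5.5 (with Thm. 5.3)] -/
def not_kClique_inTimeInst_of_eth : Prop :=
  ∀ (h : ETH),
    ¬ ∃ (f : ℕ → ℕ) (g : ℕ → ℝ), Tendsto (fun k => g k / k) atTop (𝓝 0) ∧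
      kClique.InTimeInst fun I : CliqueInstance => f I.k * (⌊(I.n : ℝ) ^ g I.k⌋₊ + 1)

/-! ### fine-grained.S20: NSETH and non-reducibility -/

/-- **fine-grained.S20** (Carmosino–Gao–Impagliazzo–Mihajlin–Paturi–Schneider,
*Nondeterministic extensions of the Strong Exponential Time Hypothesis and consequences for
non-reducibility*, ITCS 2016, §1 (main consequences) / §5.) Assuming NSETH, for every `c ≥ 2`
there is no deterministic fine-grained reduction from CNF-SAT on `n` variables with
`numClauses + size ≤ (n+1)ᶜ` (`CNFSATWithSize c`, budget `2ⁿ`) to 3SUM at its conjectured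
exponent `n²`. (CGIMPS obtain this from a co-nondeterministic `Õ(n^{3/2})` algorithm for 3SUM,
which rules out reductions even to `(3SUM, n^{3/2+γ})`; only the inventory's "conjectured
exponent" form is stated — OUTLINE R8. See the module docstring for `CNFSATWithSize c`, `2 ≤ c`
instead of the vacuous bare carrier `CNFSAT`.) [cite: CarmosinoEtAlITCS2016, §1 and §5] -/
def not_fgReducible_cnfSATWithSize_threeSUM_of_nseth : Prop :=
  ∀ (h : NSETH) (c : ℕ) (hc : 2 ≤ c),
    ¬ FGReducible (CNFSATWithSize c) (fun n => (2 : ℝ) ^ (n : ℝ)) threeSUM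
      fun n => (n : ℝ) ^ (2 : ℝ)

/-- **fine-grained.S20** (Carmosino–Gao–Impagliazzo–Mihajlin–Paturi–Schneider, ITCS 2016, §1 /
§5.) Assuming NSETH, for every `c ≥ 2` and every weight exponent `c'` there is no deterministic
fine-grained reduction from CNF-SAT on `n` variables with `numClauses + size ≤ (n+1)ᶜ`
(`CNFSATWithSize c`, budget `2ⁿ`) to APSP on `n`-node graphs with weights in `{-n^{c'}, …, n^{c'}}`
at its conjectured exponent `n³`. (CGIMPS derive it from truly subcubic (co-)nondeterministic
algorithms for APSP / Negative Triangle; the sharper nondeterministic exponent is not asserted —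
OUTLINE R8.) [cite: CarmosinoEtAlITCS2016, §1 and §5] -/
def not_fgReducible_cnfSATWithSize_apsp_of_nseth : Prop :=
  ∀ (h : NSETH) (c : ℕ) (hc : 2 ≤ c) (c' : ℕ),
    ¬ FGReducible (CNFSATWithSize c) (fun n => (2 : ℝ) ^ (n : ℝ)) (APSP c')
      fun n => (n : ℝ) ^ (3 : ℝ)

end Literature.Computability.FineGrained
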